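import Literature.GroupTheory.CombinatorialGroupTheory.PuncturedSurfaceGroupFiniteIndexAssembly
import Literature.GroupTheory.CombinatorialGroupTheory.RibbonGraphFaceSystems
import Literature.GroupTheory.CombinatorialGroupTheory.SchreierRibbonGraph
import HarnessLib

/-!
# Finite-index subgroups of punctured surface groups — the named fact DISCHARGED (GT-A)

Topic `Literature/GroupTheory/CombinatorialGroupTheory`.  The named fact
`PuncturedSurfaceGroupFiniteIndexSubgroup` (`PuncturedSurfaceGroupFiniteIndex.lean`: every finite-index
subgroup `K` of a hyperbolic punctured surface group `Γ_{g,r}` is a `Γ_{g',r'}` with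
`2g' + r' + 2[Γ:K] = [Γ:K](2g + r) + 2` and the induced peripheral structure — Hoare–Karrass–Solitar,
Math. Z. 120 (1971) Thm 1; Zieschang–Vogt–Coldewey LNM 835 Thm 4.14.1 / §4.14) is PROVED by plugging
the two layers of the cell's GT-A plan into the assembly
`PuncturedSurfaceGroup.puncturedSurfaceGroupFiniteIndexSubgroup_of_shapes`
(`PuncturedSurfaceGroupFiniteIndexAssembly.lean`, seat abc-iut-w5-d195; see also
`PuncturedSurfaceGroupFiniteIndexOfSchreier.lean` for the version modulo the Schreier layer alone):

* the SCHREIER layer `exists_schreierRibbonGraph` (`SchreierRibbonGraph.lean`,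
  seat abc-iut-w5-d186): the one-vertex boundary system of the Schreier ribbon graph of `K ≤ F(X)`
  over a one-vertex face system, with its cusp dictionary;
* the NORMAL-FORM layer `RibbonGraph.exists_puncturedSurfaceGroup_mulEquiv_of_faceSystem`
  (`RibbonGraphFaceSystems.lean`, seat abc-iut-w5-d160): a one-vertex face system is the peripheral
  system of a punctured surface group.

Theorems only; no hypotheses remain.

## References

* A. H. M. Hoare, A. Karrass, D. Solitar, *Subgroups of finite index of Fuchsian groups*, Math. Z.
  120 (1971) 289–298, Thm 1. [HoareKarrassSolitar1971]
* H. Zieschang, E. Vogt, H.-D. Coldewey, *Surfaces and Planar Discontinuous Groups*, LNM 835,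
  Springer 1980, Thm 4.14.1, §4.14. [ZieschangVogtColdewey1980]
-/

namespace Literature.GroupTheory.CombinatorialGroupTheory

/-- **Finite-index subgroups of punctured surface groups are punctured surface groups, with the
induced peripheral structure (Riemann–Hurwitz)** — the named fact
`PuncturedSurfaceGroupFiniteIndexSubgroup`, proved (Hoare–Karrass–Solitar 1971 Thm 1;
ZVC LNM 835 Thm 4.14.1). [cite: ZieschangVogtColdewey1980, Thm 4.14.1 p.150] -/
theorem puncturedSurfaceGroupFiniteIndexSubgroup_holds :
    Literature.GroupTheory.CombinatorialGroupTheory.PuncturedSurfaceGroupFiniteIndexSubgroup :=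
  PuncturedSurfaceGroup.puncturedSurfaceGroupFiniteIndexSubgroup_of_shapes
    (fun S hd hc hne htr K hK => exists_schreierRibbonGraph S hd hc hne htr K hK)
    (fun Fs h0 hd hc hne htr =>
      RibbonGraph.exists_puncturedSurfaceGroup_mulEquiv_of_faceSystem Fs h0 hd hc hne htr)

end Literature.GroupTheory.CombinatorialGroupTheory
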